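import Literature.Topology.PlanarFoliations.ProngStarEnds
import Literature.Topology.PlanarFoliations.OrderIsoExtend
import HarnessLib

/-!
# Prong junctions: flow boxes and transversals at the prong points of a star

Topic: Topology / PlanarFoliations, sequel to `ProngStar.lean`, `ProngStarEnds.lean`. At a point `a = pt j (β, 0)` of a prong of an `n`-prong star `P` at `v`,
with `β > 0` small, we fix the local apparatus by which fences along the separatrix through `a`
are connected to the local model of the star (the "junctions" of the fences over the walks of the
separatrix graph):

* `ProngStar.exists_ball_subset_S` (**proved**): **small balls around the points of a prong close
  to `v` lie in the sector** (and avoid `v`): the star is a neighbourhood of `v`, the other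
  sectors are compact and do not contain `a`.
* `ProngBox` (**structure**) and `ProngStar.exists_prongBox` (**proved**): a flow box `c` of the
  planar foliation at `a`, a ball around `ι a` inside the sector and the domain, and a
  neighbourhood `U` of `a` in `c.source` over that ball on which the heights of `c` increase with
  the common height `H` of the star (`ProngStar.foliated`).
* `ProngBox.T₁` (**definition**): for a level conversion `χ : ℝ ≃o ℝ` (`χ τ₀ = 0`) the **star
  vertical** `τ ↦` the point of `X` over `pt j (β, χ τ)`; `ProngBox.exists_radius` (**proved**):
  for levels near `τ₀` it runs in `U`, continuously, with `ι (T₁ τ) = pt j (β, χ τ)`.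
* `ProngBox.heightIso` (**definition**, `ℝ ≃o ℝ`) and `ProngBox.heightIso_spec` (**proved**): the
  height of `c` along the star vertical, extended to an order isomorphism of `ℝ`
  (`orderIsoExtend`).
* `ProngBox.H_eq_of_height_eq` (**proved**): points of `U` on one plaque of `c` have the same
  height `H`.
* Real-variable lemmas on the uniqueness of inverse germs (`eventuallyEq_of_rightInverse_symm`,
  `eventuallyEq_symm_of_leftInverse`) (**proved**).

All statements are [folklore].
-/

noncomputable section

open Set Filter Function Metric
open _root_.Topology
open Literature.Topology.FourManifolds Literature.Topology.FourManifolds.Foliation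

namespace Literature.Topology.PlanarFoliations

/-! ## Uniqueness of inverse germs -/

/-- **A right inverse near `τ₀` of a germ equal near `e τ₀` to `e.symm` is `e` near `τ₀`.**
[folklore] -/
theorem eventuallyEq_of_rightInverse_symm {φ ψ : ℝ → ℝ} {τ₀ : ℝ} (e : ℝ ≃o ℝ) (hφ : φ =ᶠ[𝓝 (e τ₀)] e.symm)
    (hψ : ContinuousAt ψ τ₀) (hψ₀ : ψ τ₀ = e τ₀) (hright : ∀ᶠ τ in 𝓝 τ₀, φ (ψ τ) = τ) : ψ =ᶠ[𝓝 τ₀] e := by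
  have h₁ : ∀ᶠ τ in 𝓝 τ₀, φ (ψ τ) = e.symm (ψ τ) := by
    have : Tendsto ψ (𝓝 τ₀) (𝓝 (e τ₀)) := by rw [← hψ₀]; exact hψ
    exact this.eventually hφ
  filter_upwards [h₁, hright] with τ ha hb
  rw [ha] at hb
  -- `e.symm (ψ τ) = τ` hence `ψ τ = e τ`
  have := congrArg e hb
  rwa [e.apply_symm_apply] at this

/-- **A left inverse near `τ₀` of a function equal near `τ₀` to `e` is `e.symm` near `e τ₀`.**
[folklore] -/
theorem eventuallyEq_symm_of_leftInverse {φ ψ : ℝ → ℝ} {τ₀ : ℝ} (e : ℝ ≃o ℝ) (hagree : ψ =ᶠ[𝓝 τ₀] e)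
    (hleft : ∀ᶠ s in 𝓝 τ₀, φ (ψ s) = s) : φ =ᶠ[𝓝 (e τ₀)] e.symm := by
  have hc : Tendsto e.symm (𝓝 (e τ₀)) (𝓝 τ₀) := by
    have := e.symm.continuous.continuousAt (x := e τ₀)
    rwa [ContinuousAt, e.symm_apply_apply] at this
  filter_upwards [hc.eventually hagree, hc.eventually hleft] with r ha hb
  -- `s = e.symm r`: `ψ s = e s = r`, `φ (ψ s) = s`
  rw [ha, e.apply_symm_apply] at hb
  exact hb

variable {X : Type*} [TopologicalSpace X] {F : Foliation ℝ X} {ι : X → ℂ} {v : ℂ} {n : ℕ}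

namespace ProngStar

variable (P : ProngStar F ι v n)

/-! ## Small balls around prong points lie in the sector -/

/-- **Small balls around the points of a prong close to `v` lie in the sector and avoid `v`.**
[folklore] -/
theorem exists_ball_subset_S [NeZero n] (j : ZMod n) :
    ∃ β₁ ∈ Ioc 0 P.ρ, ∀ β ∈ Ioc 0 β₁, ∃ r > 0, ball (P.pt j (β, 0)) r ⊆ P.S j \ {v} := by
  obtain ⟨δ, hδ, hball⟩ := Metric.mem_nhds_iff.1 P.iUnion_mem_nhds
  -- prong points close to `v`
  obtain ⟨β₁, hβ₁, hclose⟩ := P.exists_dist_pt_lt j (half_pos hδ)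
  refine ⟨min (β₁ / 2) P.ρ, ⟨lt_min (half_pos hβ₁) P.ρ_pos, min_le_right _ _⟩, fun β hβ ↦ ?_⟩
  have hβρ : β ∈ Ioc 0 P.ρ := ⟨hβ.1, hβ.2.trans (min_le_right _ _)⟩
  have hrect : ((β, 0) : ℝ × ℝ) ∈ P.rect := (P.mem_rect_iff).2 ⟨⟨hβρ.1.le, hβρ.2⟩, by simp [P.ρ_pos.le]⟩
  have hne : ((β, 0) : ℝ × ℝ) ≠ 0 := fun h0 ↦ by simp [Prod.ext_iff] at h0; linarith [hβ.1]
  set a := P.pt j (β, 0) with ha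
  have hav : a ≠ v := P.pt_ne hrect hne
  have hadist : dist a v < δ / 2 := by
    refine hclose _ hrect ?_
    have : ‖((β, 0) : ℝ × ℝ)‖ = β := by simp [Prod.norm_def, abs_of_pos hβ.1, hβ.1.le]
    rw [this]; linarith [hβ.2, min_le_left (β₁ / 2) P.ρ]
  have haS : a ∈ P.S j := P.pt_mem hrect
  have hab : P.b j a = β := P.b_pt hrect
  -- `a` is not in the other sectors
  have hnot : ∀ i, i ≠ j → a ∉ P.S i := by
    intro i hij hai
    rcases P.eq_of_mem_inter j i a ⟨haS, hai⟩ hav with h | h | h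
    · exact hij h
    · -- `i = j + 1`: `a` on the axis of `j`
      subst h
      have := (P.b_eq_zero_of_mem_inter ⟨haS, hai⟩).1
      rw [hab] at this; linarith [hβ.1]
    · -- `j = i + 1`: `a` on the axis of `j = i + 1`
      have hai' : a ∈ P.S i ∩ P.S (i + 1) := ⟨hai, h ▸ haS⟩
      have := (P.b_eq_zero_of_mem_inter hai').2.1
      rw [← h, hab] at this; linarith [hβ.1]
  -- distance to the other sectors
  have hpos : ∀ i, i ≠ j → 0 < infDist a (P.S i) := fun i hij ↦ by
    rcases (P.S i).eq_empty_or_nonempty with he | hne'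
    · exact absurd (P.mem i) (by rw [he]; exact notMem_empty _)
    · exact (IsClosed.notMem_iff_infDist_pos (P.isCompact i).isClosed hne').1 (hnot i hij)
  classical
  set others := (Finset.univ.filter fun i : ZMod n ↦ i ≠ j) with hothers
  set r₀ : ℝ := if hne' : others.Nonempty then others.inf' hne' (fun i ↦ infDist a (P.S i)) else 1 with hr₀
  have hr₀pos : 0 < r₀ := by
    rw [hr₀]; split_ifs with hne'
    · exact (Finset.lt_inf'_iff hne').2 fun i hi ↦ hpos i (Finset.mem_filter.1 hi).2
    · exact one_pos
  have hr₀le : ∀ i, i ≠ j → r₀ ≤ infDist a (P.S i) := fun i hij ↦ by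
    have hi : i ∈ others := Finset.mem_filter.2 ⟨Finset.mem_univ _, hij⟩
    rw [hr₀, dif_pos ⟨i, hi⟩]
    exact Finset.inf'_le _ hi
  set r := min r₀ (min (δ / 2) (dist a v)) with hr
  have hrpos : 0 < r := lt_min hr₀pos (lt_min (half_pos hδ) (dist_pos.2 hav))
  refine ⟨r, hrpos, fun z hz ↦ ⟨?_, ?_⟩⟩
  · -- in the star, not in the other sectors
    rw [mem_ball] at hz
    have hzv : z ∈ ball v δ := by
      rw [mem_ball]
      calc dist z v ≤ dist z a + dist a v := dist_triangle _ _ _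
        _ < δ / 2 + δ / 2 := add_lt_add (hz.trans_le ((min_le_right _ _).trans (min_le_left _ _))) hadist
        _ = δ := by ring
    obtain ⟨i, hi⟩ := mem_iUnion.1 (hball hzv)
    by_cases hij : i = j
    · exact hij ▸ hi
    · exfalso
      have h₁ : infDist a (P.S i) ≤ dist a z := infDist_le_dist_of_mem hi
      have h₂ : dist a z < r₀ := by rw [dist_comm]; exact hz.trans_le (min_le_left _ _)
      linarith [hr₀le i hij]
  · -- not `v`
    rintro rfl
    rw [mem_ball] at hz
    linarith [min_le_right r₀ (min (δ / 2) (dist a z)), min_le_right (δ / 2) (dist a z), dist_comm a z]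

end ProngStar

/-! ## Prong boxes -/

variable [Nonempty X]

/-- **A prong box** at the prong point `pt j (β, 0)`: a flow box `c` of the planar foliation at
the point `a` of `X` over it, a ball around `pt j (β, 0)` inside the sector and the domain, and a
neighbourhood `U ⊆ c.source` of `a` over that ball on which `c`-heights increase with `H`. [folklore] -/
structure ProngBox (P : ProngStar F ι v n) (hι : IsOpenEmbedding ι) (j : ZMod n) (β : ℝ) where
  /-- radius of the ball in the plane -/
  r : ℝ
  r_pos : 0 < r
  ball_subset : ball (P.pt j (β, 0)) r ⊆ P.S j \ {v}
  /-- the flow box -/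
  c : OpenPartialHomeomorph X (ℝ × ℝ)
  c_mem : c ∈ F.atlas
  /-- the neighbourhood of the base point -/
  U : Set X
  U_mem : U ∈ 𝓝 (ProngStar.lift hι (P.pt j (β, 0)))
  U_subset : U ⊆ c.source
  image_U_subset : ι '' U ⊆ ball (P.pt j (β, 0)) r
  corr : ∀ y ∈ U, ∀ z ∈ U, ((c y).2 < (c z).2 ↔ P.H (ι y) < P.H (ι z))

namespace ProngStar

variable (P : ProngStar F ι v n) (hι : IsOpenEmbedding ι)

omit [Nonempty X] in
/-- The ball of a prong point is in the range of `ι`. [folklore] -/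
theorem ball_subset_range {j : ZMod n} {β r : ℝ} (h : ball (P.pt j (β, 0)) r ⊆ P.S j \ {v}) :
    ball (P.pt j (β, 0)) r ⊆ range ι := fun _ hz ↦ P.diff_subset_range j (h hz)

/-- **Prong boxes exist** at the prong points close to `v`. [folklore] -/
theorem exists_prongBox [NeZero n] (j : ZMod n) :
    ∃ β₁ ∈ Ioc 0 P.ρ, ∀ β ∈ Ioc 0 β₁, Nonempty (ProngBox P hι j β) := by
  obtain ⟨β₁, hβ₁, hballs⟩ := P.exists_ball_subset_S j
  refine ⟨β₁, hβ₁, fun β hβ ↦ ?_⟩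
  obtain ⟨r, hr, hball⟩ := hballs β hβ
  set z₀ := P.pt j (β, 0) with hz₀
  set a := ProngStar.lift hι z₀ with ha
  have hz₀r : z₀ ∈ range ι := P.ball_subset_range (hball) (mem_ball_self hr)
  have hιa : ι a = z₀ := ProngStar.ι_lift hι hz₀r
  have haS : ι a ∈ P.S j := by rw [hιa]; exact (hball (mem_ball_self hr)).1
  obtain ⟨e, he, hae, U₀, hU₀, hcorr⟩ := P.foliated j a haS
  have hpre : ι ⁻¹' ball z₀ r ∈ 𝓝 a := hι.continuous.continuousAt.preimage_mem_nhds (by rw [hιa]; exact ball_mem_nhds _ hr)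
  refine ⟨⟨r, hr, hball, e, he, U₀ ∩ e.source ∩ ι ⁻¹' ball z₀ r,
    inter_mem (inter_mem hU₀ (e.open_source.mem_nhds hae)) hpre, fun y hy ↦ hy.1.2, ?_, fun y hy z hz ↦ ?_⟩⟩
  · rintro _ ⟨y, hy, rfl⟩; exact hy.2
  · exact hcorr y hy.1.1 (hball hy.2).1 z hz.1.1 (hball hz.2).1

end ProngStar

namespace ProngBox

variable {P : ProngStar F ι v n} {hι : IsOpenEmbedding ι} {j : ZMod n} {β : ℝ}

/-- The base point of the prong box: the point of `X` over `pt j (β, 0)`. [folklore] -/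
def base (_K : ProngBox P hι j β) : X := ProngStar.lift hι (P.pt j (β, 0))

variable (K : ProngBox P hι j β)

/-- The base point lies over `pt j (β, 0)`. [folklore] -/
theorem ι_base : ι K.base = P.pt j (β, 0) :=
  ProngStar.ι_lift hι (P.ball_subset_range K.ball_subset (mem_ball_self K.r_pos))

/-- The base point is in `U`. [folklore] -/
theorem base_mem_U : K.base ∈ K.U := mem_of_mem_nhds K.U_mem

/-- The base point is in the source of the box. [folklore] -/
theorem base_mem_source : K.base ∈ K.c.source := K.U_subset K.base_mem_U

/-- Points of `U` lie over the sector. [folklore] -/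
theorem image_mem_S {y : X} (hy : y ∈ K.U) : ι y ∈ P.S j :=
  (K.ball_subset (K.image_U_subset ⟨y, hy, rfl⟩)).1

/-- **Points of `U` on one plaque of `c` have the same height `H`.** [folklore] -/
theorem H_eq_of_height_eq {y z : X} (hy : y ∈ K.U) (hz : z ∈ K.U) (h : (K.c y).2 = (K.c z).2) :
    P.H (ι y) = P.H (ι z) := by
  rcases lt_trichotomy (P.H (ι y)) (P.H (ι z)) with hlt | heq | hlt
  · have := (K.corr y hy z hz).2 hlt; rw [h] at this; exact absurd this (lt_irrefl _)
  · exact heq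
  · have := (K.corr z hz y hy).2 hlt; rw [h] at this; exact absurd this (lt_irrefl _)

/-- Points of `U` with the same height `H` lie on one plaque of `c`. [folklore] -/
theorem height_eq_of_H_eq {y z : X} (hy : y ∈ K.U) (hz : z ∈ K.U) (h : P.H (ι y) = P.H (ι z)) :
    (K.c y).2 = (K.c z).2 := by
  rcases lt_trichotomy ((K.c y).2) ((K.c z).2) with hlt | heq | hlt
  · have := (K.corr y hy z hz).1 hlt; rw [h] at this; exact absurd this (lt_irrefl _)
  · exact heq
  · have := (K.corr z hz y hy).1 hlt; rw [h] at this; exact absurd this (lt_irrefl _)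

/-! ## The star vertical -/

/-- **The star vertical** of the prong box for the level conversion `χ`: the point of `X` over
`pt j (β, χ τ)`. [folklore] -/
def T₁ (_K : ProngBox P hι j β) (χ : ℝ ≃o ℝ) (τ : ℝ) : X := ProngStar.lift hι (P.pt j (β, χ τ))

/-- **The star vertical near the base level**: for `τ` near `τ₀` (where `χ τ₀ = 0`) the point
`pt j (β, χ τ)` has coordinates in the half square, lies in the ball of the box, and `T₁ τ ∈ U`.
[folklore] -/
theorem exists_radius (hβ : β ∈ Icc 0 P.ρ) (χ : ℝ ≃o ℝ) {τ₀ : ℝ} (hχ₀ : χ τ₀ = 0) :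
    ∃ ε > (0 : ℝ), ∀ τ ∈ Ioo (τ₀ - ε) (τ₀ + ε),
      (β, χ τ) ∈ P.rect ∧ P.pt j (β, χ τ) ∈ ball (P.pt j (β, 0)) K.r ∧ K.T₁ χ τ ∈ K.U := by
  -- coordinates in the half square: `|χ τ| < ρ` near `τ₀`
  have h₁ : ∀ᶠ τ in 𝓝 τ₀, χ τ ∈ Ioo (-P.ρ) P.ρ := by
    have hc : ContinuousAt χ τ₀ := χ.continuous.continuousAt
    exact hc.preimage_mem_nhds (by rw [hχ₀]; exact Ioo_mem_nhds (by linarith [P.ρ_pos]) P.ρ_pos)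
  -- the point is near `pt j (β, 0)` and its lift in `U`
  have hcpt : ContinuousWithinAt (fun τ ↦ P.pt j (β, χ τ)) {τ | χ τ ∈ Icc (-P.ρ) P.ρ} τ₀ := by
    have hc : Continuous fun τ ↦ ((β, χ τ) : ℝ × ℝ) := continuous_const.prodMk χ.continuous
    refine ((P.continuousOn_pt j).comp hc.continuousOn fun τ hτ ↦ (P.mem_rect_iff).2 ⟨hβ, hτ⟩) τ₀ ?_
    show χ τ₀ ∈ Icc (-P.ρ) P.ρ
    rw [hχ₀]; exact ⟨by linarith [P.ρ_pos], P.ρ_pos.le⟩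
  have hcpt' : ContinuousAt (fun τ ↦ P.pt j (β, χ τ)) τ₀ :=
    hcpt.continuousAt (h₁.mono fun τ hτ ↦ Ioo_subset_Icc_self hτ)
  have h0 : P.pt j (β, χ τ₀) = P.pt j (β, 0) := by rw [hχ₀]
  have h₂ : ∀ᶠ τ in 𝓝 τ₀, P.pt j (β, χ τ) ∈ ball (P.pt j (β, 0)) K.r :=
    hcpt'.preimage_mem_nhds (by rw [h0]; exact ball_mem_nhds _ K.r_pos)
  have h₃ : ∀ᶠ τ in 𝓝 τ₀, K.T₁ χ τ ∈ K.U := by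
    have ht : Tendsto (fun τ ↦ P.pt j (β, χ τ)) (𝓝 τ₀) (𝓝[range ι] (P.pt j (β, 0))) := by
      refine tendsto_nhdsWithin_iff.2 ⟨?_, h₂.mono fun τ hτ ↦ P.ball_subset_range K.ball_subset hτ⟩
      have := hcpt'.tendsto; rwa [h0] at this
    have hl : Tendsto (ProngStar.lift hι) (𝓝[range ι] (P.pt j (β, 0))) (𝓝 (ProngStar.lift hι (P.pt j (β, 0)))) :=
      ProngStar.continuousOn_lift hι _ (P.ball_subset_range K.ball_subset (mem_ball_self K.r_pos))
    exact (hl.comp ht).eventually_mem K.U_mem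
  obtain ⟨ε, hε, hsub⟩ := IsHomeoGermAt.exists_Ioo_subset_of_mem_nhds (h₁.and (h₂.and h₃))
  exact ⟨ε, hε, fun τ hτ ↦ ⟨(P.mem_rect_iff).2 ⟨hβ, Ioo_subset_Icc_self (hsub hτ).1⟩, (hsub hτ).2.1, (hsub hτ).2.2⟩⟩

section Radius

variable {χ : ℝ ≃o ℝ} {τ₀ ε : ℝ}
  (hε : ∀ τ ∈ Ioo (τ₀ - ε) (τ₀ + ε), (β, χ τ) ∈ P.rect ∧ P.pt j (β, χ τ) ∈ ball (P.pt j (β, 0)) K.r ∧ K.T₁ χ τ ∈ K.U)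
include hε

/-- The star vertical lies over `pt j (β, χ τ)`. [folklore] -/
theorem ι_T₁ {τ : ℝ} (hτ : τ ∈ Ioo (τ₀ - ε) (τ₀ + ε)) : ι (K.T₁ χ τ) = P.pt j (β, χ τ) :=
  ProngStar.ι_lift hι (P.ball_subset_range K.ball_subset (hε τ hτ).2.1)

/-- The star vertical runs in `U`. [folklore] -/
theorem T₁_mem_U {τ : ℝ} (hτ : τ ∈ Ioo (τ₀ - ε) (τ₀ + ε)) : K.T₁ χ τ ∈ K.U := (hε τ hτ).2.2

/-- The star vertical runs in the source of the box. [folklore] -/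
theorem T₁_mem_source {τ : ℝ} (hτ : τ ∈ Ioo (τ₀ - ε) (τ₀ + ε)) : K.T₁ χ τ ∈ K.c.source :=
  K.U_subset (K.T₁_mem_U hε hτ)

/-- The height `H` along the star vertical is `χ`. [folklore] -/
theorem H_T₁ {τ : ℝ} (hτ : τ ∈ Ioo (τ₀ - ε) (τ₀ + ε)) : P.H (ι (K.T₁ χ τ)) = χ τ := by
  rw [K.ι_T₁ hε hτ, P.H_pt (hε τ hτ).1]

/-- **The star vertical is continuous** on the level interval. [folklore] -/
theorem continuousOn_T₁ : ContinuousOn (K.T₁ χ) (Ioo (τ₀ - ε) (τ₀ + ε)) := by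
  have hc : ContinuousOn (fun τ ↦ P.pt j (β, χ τ)) (Ioo (τ₀ - ε) (τ₀ + ε)) :=
    (P.continuousOn_pt j).comp (continuous_const.prodMk χ.continuous).continuousOn fun τ hτ ↦ (hε τ hτ).1
  exact (ProngStar.continuousOn_lift hι).comp hc fun τ hτ ↦ P.ball_subset_range K.ball_subset (hε τ hτ).2.1

/-- **The height of `c` along the star vertical is strictly increasing.** [folklore] -/
theorem strictMonoOn_height_T₁ : StrictMonoOn (fun τ ↦ (K.c (K.T₁ χ τ)).2) (Ioo (τ₀ - ε) (τ₀ + ε)) := by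
  intro τ hτ τ' hτ' hlt
  refine (K.corr _ (K.T₁_mem_U hε hτ) _ (K.T₁_mem_U hε hτ')).2 ?_
  rw [K.H_T₁ hε hτ, K.H_T₁ hε hτ']
  exact χ.strictMono hlt

/-- **The height of `c` along the star vertical is continuous.** [folklore] -/
theorem continuousOn_height_T₁ : ContinuousOn (fun τ ↦ (K.c (K.T₁ χ τ)).2) (Ioo (τ₀ - ε) (τ₀ + ε)) :=
  continuous_snd.comp_continuousOn (K.c.continuousOn.comp (K.continuousOn_T₁ hε) fun _ hτ ↦ K.T₁_mem_source hε hτ)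

end Radius

/-- The star vertical at the base level is the base point. [folklore] -/
theorem T₁_base {χ : ℝ ≃o ℝ} {τ₀ : ℝ} (hχ₀ : χ τ₀ = 0) : K.T₁ χ τ₀ = K.base := by
  rw [T₁, hχ₀]; rfl

/-! ## The height of the box along the star vertical, as an order isomorphism -/

/-- **The height isomorphism**: the `c`-height along the star vertical, on
`[τ₀ - ε/2, τ₀ + ε/2]`, extended to an order isomorphism of `ℝ`. [folklore] -/
def heightIso (χ : ℝ ≃o ℝ) (τ₀ ε : ℝ) (hε0 : 0 < ε)
    (hε : ∀ τ ∈ Ioo (τ₀ - ε) (τ₀ + ε), (β, χ τ) ∈ P.rect ∧ P.pt j (β, χ τ) ∈ ball (P.pt j (β, 0)) K.r ∧ K.T₁ χ τ ∈ K.U) :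
    ℝ ≃o ℝ :=
  orderIsoExtend (fun τ ↦ (K.c (K.T₁ χ τ)).2) (τ₀ - ε / 2) (τ₀ + ε / 2) (by linarith)
    ((K.continuousOn_height_T₁ hε).mono (Icc_subset_Ioo (by linarith) (by linarith)))
    ((K.strictMonoOn_height_T₁ hε).mono (Icc_subset_Ioo (by linarith) (by linarith)))

/-- **On `(τ₀ - ε/2, τ₀ + ε/2)` the height isomorphism is the height of the star vertical.**
[folklore] -/
theorem heightIso_apply {χ : ℝ ≃o ℝ} {τ₀ ε : ℝ} (hε0 : 0 < ε)
    (hε : ∀ τ ∈ Ioo (τ₀ - ε) (τ₀ + ε), (β, χ τ) ∈ P.rect ∧ P.pt j (β, χ τ) ∈ ball (P.pt j (β, 0)) K.r ∧ K.T₁ χ τ ∈ K.U)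
    {τ : ℝ} (hτ : τ ∈ Icc (τ₀ - ε / 2) (τ₀ + ε / 2)) : K.heightIso χ τ₀ ε hε0 hε τ = (K.c (K.T₁ χ τ)).2 :=
  orderIsoExtend_apply_of_mem _ _ _ hτ

/-- The star vertical lies on the plaque of `c` at height `heightIso τ`. [folklore] -/
theorem T₁_mem_plaque {χ : ℝ ≃o ℝ} {τ₀ ε : ℝ} (hε0 : 0 < ε)
    (hε : ∀ τ ∈ Ioo (τ₀ - ε) (τ₀ + ε), (β, χ τ) ∈ P.rect ∧ P.pt j (β, χ τ) ∈ ball (P.pt j (β, 0)) K.r ∧ K.T₁ χ τ ∈ K.U)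
    {τ : ℝ} (hτ : τ ∈ Ioo (τ₀ - ε / 2) (τ₀ + ε / 2)) : K.T₁ χ τ ∈ plaque K.c (K.heightIso χ τ₀ ε hε0 hε τ) :=
  ⟨K.T₁_mem_source hε ⟨by linarith [hτ.1], by linarith [hτ.2]⟩, (K.heightIso_apply hε0 hε (Ioo_subset_Icc_self hτ)).symm⟩

/-- The height isomorphism at the base level is the height of the base point. [folklore] -/
theorem heightIso_base {χ : ℝ ≃o ℝ} {τ₀ ε : ℝ} (hε0 : 0 < ε)
    (hε : ∀ τ ∈ Ioo (τ₀ - ε) (τ₀ + ε), (β, χ τ) ∈ P.rect ∧ P.pt j (β, χ τ) ∈ ball (P.pt j (β, 0)) K.r ∧ K.T₁ χ τ ∈ K.U)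
    (hχ₀ : χ τ₀ = 0) : K.heightIso χ τ₀ ε hε0 hε τ₀ = (K.c K.base).2 := by
  rw [K.heightIso_apply hε0 hε ⟨by linarith, by linarith⟩, K.T₁_base hχ₀]

/-- **Near the base point, points on the plaque of `c` at height `heightIso τ` have height
`H = χ τ`.** [folklore] -/
theorem H_eq_of_mem_plaque {χ : ℝ ≃o ℝ} {τ₀ ε : ℝ} (hε0 : 0 < ε)
    (hε : ∀ τ ∈ Ioo (τ₀ - ε) (τ₀ + ε), (β, χ τ) ∈ P.rect ∧ P.pt j (β, χ τ) ∈ ball (P.pt j (β, 0)) K.r ∧ K.T₁ χ τ ∈ K.U)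
    {τ : ℝ} (hτ : τ ∈ Ioo (τ₀ - ε / 2) (τ₀ + ε / 2)) {y : X} (hy : y ∈ K.U)
    (hh : (K.c y).2 = K.heightIso χ τ₀ ε hε0 hε τ) : P.H (ι y) = χ τ := by
  have hτ' : τ ∈ Ioo (τ₀ - ε) (τ₀ + ε) := ⟨by linarith [hτ.1], by linarith [hτ.2]⟩
  rw [K.heightIso_apply hε0 hε (Ioo_subset_Icc_self hτ)] at hh
  rw [K.H_eq_of_height_eq hy (K.T₁_mem_U hε hτ') hh, K.H_T₁ hε hτ']

end ProngBox



end Literature.Topology.PlanarFoliations
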